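import Literature.MathematicalPhysics.QuantumLattice.XXZAntiferromagnetInfiniteVolumeOrder
import Literature.MathematicalPhysics.QuantumLattice.HeisenbergOrderMerminWagnerMagnetisationProofs
import Literature.MathematicalPhysics.QuantumLattice.InfiniteVolumeStatesProofs
import HarnessLib

/-!
# Mermin–Wagner for the infinitesimal-field states of the XXZ / Heisenberg antiferromagnet:
# in `d ≤ 2` at `T > 0` the spontaneous staggered magnetisation of KT93 (1.8)–(1.9) VANISHES

Koma–Tasaki, Commun. Math. Phys. **158** (1993) 191, §1 (1.8)–(1.10) construct the equilibrium state of the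
XXZ / Heisenberg antiferromagnet on `ℤ^d` with an infinitesimal symmetry-breaking staggered field,
`ω̃ = lim_{B↓0} lim_{Λ↑ℤ^d} ⟨·⟩_{β, H_Λ - BO^α_Λ}` (tree: `XXZKT.IsInfinitesimalFieldThermalState`, realised along even
tori and subsequences, `XXZAntiferromagnetInfiniteVolumeOrder.lean`), and show that its spontaneous staggered
magnetisation `m_s = (-1)^x ω̃(Ŝ^α_x)` (1.9) dominates the long-range order parameter; the tree PROVES the floors
`m_s ≥ √2σ, √3σ > 0` for `d ≥ 3` at low temperature and for `d ≥ 2` in the ground state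
(`xxzAF_infiniteVolume_spontaneousStaggeredMagnetisation`, `heisenbergAF_infiniteVolume_…`, `…_groundState_…`).

This file PROVES the complementary CEILING in low dimension at positive temperature — the **Mermin–Wagner
theorem** (N. D. Mermin, H. Wagner, *Absence of ferromagnetism or antiferromagnetism in one- or two-dimensional
isotropic Heisenberg models*, PRL **17** (1966) 1133) in its original ONE-POINT form with a STAGGERED field, for the
XXZ family and these very states:

* §1–§2 (operator identities, any finite set of sites / finite graph): the commutators of the spin components with
  the deformed generator `C = Σ_z f_z Ŝᶻ_z` of the `U(1)` symmetry of `H^{XXZ}` and Mermin–Wagner's double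
  commutator in real space, `[C,[K,C]] = -J Σ_{⟨x,y⟩}(f_x - f_y)²(B⁰_{xy} + B¹_{xy}) + Σ_x b_x f_x² Ŝ^α_x` for
  `K = H^{XXZ}(J,Δ) - Σ_x b_x Ŝ^α_x` with an ARBITRARY planar field profile `b` (`doubleComm_xxz_with_planarField`;
  the `Δ`-term commutes with `C`), and the axial twin for the Heisenberg model (`doubleComm_heisenberg_with_axialField`);
* §3 (the local bound, any finite graph): Bogoliubov's inequality (`bogoliubov_inequality`) with this `C` and `A` the
  other planar component gives `(Re⟨Ŝ^α_o⟩_{β,K})² ≤ β S² (2|J| S² Σ_{⟨x,y⟩}(f_x - f_y)² + S Σ_x |b_x| f_x²)` for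
  every real weight `f` with `f(o) = 1` (`sq_re_gibbsState_planarSpin_le`, `α ∈ {x,y}`, every `Δ`;
  `sq_re_gibbsState_axialSpin_heisenberg_le`, `α = z`, `Δ = 1`);
* §4 (the sourced antiferromagnet `K = H^{XXZ} - B·O^α`, `XXZKT.sourcedAF`): on any graph
  (`XXZKT.sq_re_gibbsState_siteSpin_sourced_le`) and then on the torus `(ℤ/Lℤ)^d`, `d ∈ {1,2}`, with the harmonic
  radial test function of the tree's uniform-field proof (`HeisenbergOrderMerminWagnerMagnetisationProofs`):
  `(Re⟨Ŝ^α_o⟩_{β,K})² ≤ β S² (2|J| S²·64/H_R + |B| S·4R²)` for every `R ≥ 1`, UNIFORMLY IN `L`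
  (`XXZKT.sq_re_gibbsState_siteSpin_sourcedAF_le`), whenever `α ∈ {x,y}` or `Δ = 1`;
* §5 (infinite volume): the ceiling passes to every sourced thermal limit state
  (`XXZKT.IsSourcedThermalLimit.sq_re_expect_siteSpinAt_le`) and, as `B ↓ 0` and then `H_R → ∞`, forces
  **`ω̃(Ŝ^α_x) = 0` at every site for every infinitesimal-field thermal state in `d ≤ 2`, `β ≥ 0`**
  (`XXZKT.IsInfinitesimalFieldThermalState.expect_siteSpinAt_eq_zero`): no spontaneous planar staggered
  magnetisation for any anisotropy `Δ` (`XXZKT.xxz_lowDimension_noSpontaneousPlanarMagnetisation`), and for the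
  Heisenberg antiferromagnet none in any direction (`XXZKT.heisenbergAF_lowDimension_noSpontaneousStaggeredMagnetisation`).

Together with the tree's floors this completes the `(d, T)` table of the order parameter (1.9) of these states for
the `U(1)`/`SU(2)`-symmetric cases: `> 0` for (`d ≥ 3`, `T` small) and (`d ≥ 2`, `T = 0`, `(d,S) ≠ (2,½)` typed);
`= 0` for (`d ≤ 2`, `T > 0`).  Everything is PROVED (standard axioms); no definition, no named fact.

WHAT THIS IS NOT: not a floor (it is the Mermin–Wagner ceiling `= 0`); not the Klein–Landau–Shucker /
Fröhlich–Pfister theorem that EVERY KMS state in `d ≤ 2` is invariant (only the KT93 torus-limit states and their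
`B ↓ 0` limits are treated; cited, not formalised); nothing about the axial (Ising) order of the XXZ model with
`Δ > 1`, which does occur in `d = 2`; nothing about the Hubbard model (its `T > 0` no-order theorems are
`HubbardPeriodicEquilibriumStatesNoMagneticOrder`, `HubbardTTPrimeEquilibriumStatesNoPairing`).

## Mathlib / tree search

REUSED (not re-proved): `bogoliubov_inequality` (`BogoliubovInequality`); `Matrix.IsHermitian.re_gibbsState_doubleComm_nonneg`
(`DuhamelTwoPoint`); from `HeisenbergOrderMerminWagnerMagnetisationProofs` the abstract identities `doubleComm_sum_three_mul`,
`doubleComm_of_comm_sub_eq_smul`, `siteSpin_mul_sum_smul_siteSpin`, the `x`-axis lemmas `siteSpin_one_comm_sub`,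
`doubleComm_spinDot`, `doubleComm_siteSpin_two`, `mwBondWeight_symm`, `abs_re_gibbsState_mwBondWeight_le`, the Gibbs/Loewner
bounds `re_gibbsState_le_of_posSemidef`, `abs_re_gibbsState_le_of_posSemidef`, `posSemidef_sq_smul_one_{sub,add}_spinBond`,
`sum_smul_siteSpin_isHermitian`, and the torus estimates `sum_edgeFinset_radial_sq_le`, `sum_radial_le_sum_range`,
`harmonicProfile_*`, `sum_shell_harmonicProfile_sq_le`, `one_le_sum_range_one_div_succ`, `sum_range_two_mul_cast_add_one`,
`exists_harmonicSum_ge`; `posSemidef_smul_one_{sub,add}_siteSpin`, `posSemidef_sq_smul_one_sub_siteSpin_sq`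
(`XYOrderDischarges`); `lie_spinZ_spinX`, `lie_spinY_spinZ` (`SpinOperatorsProofs`); `XXZKT.sourcedAF`, `XXZKT.stagSpin`,
`XXZKT.abs_stagSign`, `XXZKT.IsSourcedLimit`, `XXZKT.IsInfinitesimalFieldState`, `XXZKT.IsSourcedThermalLimit`,
`XXZKT.IsInfinitesimalFieldThermalState`, `XXZKT.exists_isInfinitesimalFieldThermalState`, `XXZKT.siteSpinAt`
(`XXZAntiferromagnetInfiniteVolumeOrder`, `XXZAntiferromagnetThermalSpontaneousOrder`); `InfVolState.IsTorusLimitOf.tendsto_onSite`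
(`SpinTorusLimitStates`); `InfVolState.im_expect_eq_zero_of_isHermitian` (`InfiniteVolumeStatesProofs`).
`rg sourcedAF` (2026-08-29): only the four KT93 infinite-volume files; no one-point Mermin–Wagner bound with a staggered
field or for the XXZ model existed (`mermin_wagner_magnetisation_holds`: uniform field, Heisenberg; `mermin_wagner_general_holds`
and `…_staggered`: two-point functions at `B = 0`).

## References

* [MerminWagnerPRL1966] N. D. Mermin, H. Wagner, Phys. Rev. Lett. **17** (1966) 1133–1136, pp. 1133–1135 (Bogoliubov
  inequality, staggered field `h(𝐊)`, `|s_z(𝐊)| < const (T|ln|h||)^{-1/2}` in `d = 2`, `const T^{-2/3}|h|^{1/3}` in `d = 1`).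
* [GelfertNolting2001] A. Gelfert, W. Nolting, J. Phys.: Condens. Matter **13** (2001) R505, §2.3 eq. (9), §3 eqs. (41)–(52).
* [KomaTasaki1993] T. Koma, H. Tasaki, Commun. Math. Phys. **158** (1993) 191–214, §1 (1.8)–(1.10), Corollary 1.1.
* [KleinLandauShucker1981] A. Klein, L. J. Landau, D. S. Shucker, J. Stat. Phys. **26** (1981) 505–512 (every KMS state
  in `d ≤ 2` is invariant under a continuous symmetry; cited, not formalised).
* [Tasaki2020] H. Tasaki, *Physics and Mathematics of Quantum Many-Body Systems*, §2.1 (2.1.1), §4.4.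
-/

noncomputable section

namespace Literature.MathematicalPhysics.QuantumLattice

open Finset Matrix Complex _root_.Filter Literature.Probability.LatticeModels
  Literature.MathematicalPhysics.QuantumLattice.SpinOperators
open scoped ComplexOrder MatrixOrder _root_.Topology

/-! ### §1 Commutators with the generator `C = Σ_z f(z) Ŝᶻ_z` of (deformed) rotations about the `z`-axis -/

section RotZ

variable {Λ : Type*} [Fintype Λ] [DecidableEq Λ] (n : ℕ)

/-- `[Ŝᶻ_x, C] = 0` for `C = Σ_z f_z Ŝᶻ_z` (spins at distinct sites commute, `[Ŝᶻ, Ŝᶻ] = 0`).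
[cite: Tasaki2020, §2.2 eqs. (2.2.6), (2.2.11)] -/
theorem siteSpin_two_comm_rotZ (f : Λ → ℂ) (x : Λ) :
    (siteSpin n x 2 * (∑ z, f z • siteSpin n z 2) - (∑ z, f z • siteSpin n z 2) * siteSpin n x 2 :
      Op Λ (n + 1)) = 0 := by
  rw [siteSpin_mul_sum_smul_siteSpin, Ring.lie_def, sub_self, onSite_zero, smul_zero, add_zero,
    sub_self]

/-- `[Ŝˣ_x, C] = -i f_x Ŝʸ_x` for `C = Σ_z f_z Ŝᶻ_z` (`[Sˣ, Sᶻ] = -iSʸ`).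
[cite: Tasaki2020, §2.1 eq. (2.1.1) and §2.2 eq. (2.2.6)] -/
theorem siteSpin_zero_comm_rotZ (f : Λ → ℂ) (x : Λ) :
    (siteSpin n x 0 * (∑ z, f z • siteSpin n z 2) - (∑ z, f z • siteSpin n z 2) * siteSpin n x 0 :
      Op Λ (n + 1)) = (-(f x * I)) • siteSpin n x 1 := by
  have hc : ⁅spinVec n 0, spinVec n 2⁆ = -(I • spinVec n 1) := by
    rw [spinVec_zero, spinVec_one, spinVec_two, ← lie_spinZ_spinX, Ring.lie_def, Ring.lie_def, neg_sub]
  rw [siteSpin_mul_sum_smul_siteSpin, add_sub_cancel_left, hc, onSite_neg', onSite_smul', smul_neg,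
    smul_smul, neg_smul]
  rfl

/-- `[Ŝʸ_x, C] = i f_x Ŝˣ_x` for `C = Σ_z f_z Ŝᶻ_z` (`[Sʸ, Sᶻ] = iSˣ`).
[cite: Tasaki2020, §2.1 eq. (2.1.1) and §2.2 eq. (2.2.6)] -/
theorem siteSpin_one_comm_rotZ (f : Λ → ℂ) (x : Λ) :
    (siteSpin n x 1 * (∑ z, f z • siteSpin n z 2) - (∑ z, f z • siteSpin n z 2) * siteSpin n x 1 :
      Op Λ (n + 1)) = (f x * I) • siteSpin n x 0 := by
  have hc : ⁅spinVec n 1, spinVec n 2⁆ = I • spinVec n 0 := by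
    rw [spinVec_zero, spinVec_one, spinVec_two, lie_spinY_spinZ]
  rw [siteSpin_mul_sum_smul_siteSpin, add_sub_cancel_left, hc, onSite_smul', smul_smul]
  rfl

/-- **`[[Δ Ŝᶻ_xŜᶻ_y + Ŝˣ_xŜˣ_y + Ŝʸ_xŜʸ_y, C], C] = (f_x - f_y)² (Ŝˣ_xŜˣ_y + Ŝʸ_xŜʸ_y)`** for
`C = Σ_z f_z Ŝᶻ_z`: the exchange part of Mermin–Wagner's double commutator for the XXZ bond and the
generator of its `U(1)` symmetry (the `Δ`-term commutes with `C`). Mermin–Wagner (1966) p. 1134;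
Gelfert–Nolting (2001) eq. (47). [cite: MerminWagnerPRL1966, p. 1134] -/
theorem doubleComm_planarPair_rotZ (f : Λ → ℂ) (Δ : ℂ) (x y : Λ) (C : Op Λ (n + 1))
    (hC : C = ∑ z, f z • siteSpin n z 2) :
    ((Δ • siteSpin n x 2 * siteSpin n y 2 + siteSpin n x 0 * siteSpin n y 0 +
            siteSpin n x 1 * siteSpin n y 1) * C -
          C * (Δ • siteSpin n x 2 * siteSpin n y 2 + siteSpin n x 0 * siteSpin n y 0 +
            siteSpin n x 1 * siteSpin n y 1)) * C -
        C * ((Δ • siteSpin n x 2 * siteSpin n y 2 + siteSpin n x 0 * siteSpin n y 0 +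
            siteSpin n x 1 * siteSpin n y 1) * C -
          C * (Δ • siteSpin n x 2 * siteSpin n y 2 + siteSpin n x 0 * siteSpin n y 0 +
            siteSpin n x 1 * siteSpin n y 1)) =
      (f x - f y) ^ 2 • (siteSpin n x 0 * siteSpin n y 0 + siteSpin n x 1 * siteSpin n y 1) := by
  subst hC
  have hX₀ : (Δ • siteSpin n x 2) * (∑ z, f z • siteSpin n z 2) -
      (∑ z, f z • siteSpin n z 2) * (Δ • siteSpin n x 2) = (0 : Op Λ (n + 1)) := by
    rw [smul_mul_assoc, mul_smul_comm, ← smul_sub, siteSpin_two_comm_rotZ, smul_zero]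
  rw [doubleComm_sum_three_mul hX₀ (siteSpin_zero_comm_rotZ n f x) (siteSpin_one_comm_rotZ n f x)
    (siteSpin_two_comm_rotZ n f y) (siteSpin_zero_comm_rotZ n f y) (siteSpin_one_comm_rotZ n f y),
    smul_add]
  congr 2
  · ring_nf
    rw [I_sq]
    ring
  · ring_nf
    rw [I_sq]
    ring

/-- Unfolding of the XXZ bond term into the two ordered "planar pairs":
`B⁰_{xy} + B¹_{xy} + Δ B²_{xy} = ½[(ΔŜᶻ_xŜᶻ_y + Ŝˣ_xŜˣ_y + Ŝʸ_xŜʸ_y) + (x ↔ y)]` (the symmetrised bond operators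
of the XXZ Hamiltonian). [cite: Tasaki2020, §2.4 eq. (2.4.1) and the remarks after it] -/
theorem xxzBond_eq_half_planarPairs (Δ : ℂ) (x y : Λ) :
    (spinBond n 0 x y + spinBond n 1 x y + Δ • spinBond n 2 x y : Op Λ (n + 1)) =
      (1 / 2 : ℂ) • (Δ • siteSpin n x 2 * siteSpin n y 2 + siteSpin n x 0 * siteSpin n y 0 +
          siteSpin n x 1 * siteSpin n y 1) +
        (1 / 2 : ℂ) • (Δ • siteSpin n y 2 * siteSpin n x 2 + siteSpin n y 0 * siteSpin n x 0 +
          siteSpin n y 1 * siteSpin n x 1) := by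
  simp only [spinBond, smul_add, smul_mul_assoc, smul_smul]
  module

/-- The planar Mermin–Wagner bond weight `(f_x - f_y)² (B⁰_{xy} + B¹_{xy})` is symmetric in `x, y` (so that the
double commutator is a function on the unordered bonds). [cite: MerminWagnerPRL1966, p. 1134] -/
theorem planarBondWeight_symm (f : Λ → ℂ) (x y : Λ) :
    (f x - f y) ^ 2 • (spinBond n 0 x y + spinBond n 1 x y) =
      (f y - f x) ^ 2 • (spinBond n 0 y x + spinBond n 1 y x) := by
  rw [spinBond_comm n 0 x y, spinBond_comm n 1 x y, show (f y - f x) ^ 2 = (f x - f y) ^ 2 by ring]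

/-- **`[[B⁰_{xy} + B¹_{xy} + Δ B²_{xy}, C], C] = (f_x - f_y)² (B⁰_{xy} + B¹_{xy})`** for the
symmetrised XXZ bond and `C = Σ_z f_z Ŝᶻ_z`. Mermin–Wagner (1966) p. 1134. [cite: MerminWagnerPRL1966, p. 1134] -/
theorem doubleComm_xxzBond_rotZ (f : Λ → ℂ) (Δ : ℂ) (x y : Λ) (C : Op Λ (n + 1))
    (hC : C = ∑ z, f z • siteSpin n z 2) :
    ((spinBond n 0 x y + spinBond n 1 x y + Δ • spinBond n 2 x y) * C -
          C * (spinBond n 0 x y + spinBond n 1 x y + Δ • spinBond n 2 x y)) * C -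
        C * ((spinBond n 0 x y + spinBond n 1 x y + Δ • spinBond n 2 x y) * C -
          C * (spinBond n 0 x y + spinBond n 1 x y + Δ • spinBond n 2 x y)) =
      (f x - f y) ^ 2 • (spinBond n 0 x y + spinBond n 1 x y) := by
  set D : Op Λ (n + 1) →ₗ[ℂ] Op Λ (n + 1) :=
    LinearMap.mulRight ℂ C - LinearMap.mulLeft ℂ C with hD
  have hDapp : ∀ Z : Op Λ (n + 1), D Z = Z * C - C * Z := fun Z => rfl
  have hxy := doubleComm_planarPair_rotZ n f Δ x y C hC
  have hyx := doubleComm_planarPair_rotZ n f Δ y x C hC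
  rw [← hDapp, ← hDapp] at hxy hyx
  have hbond : (spinBond n 0 x y + spinBond n 1 x y : Op Λ (n + 1)) = (1 / 2 : ℂ) •
      ((siteSpin n x 0 * siteSpin n y 0 + siteSpin n x 1 * siteSpin n y 1) +
        (siteSpin n y 0 * siteSpin n x 0 + siteSpin n y 1 * siteSpin n x 1)) := by
    simp only [spinBond, ← smul_add]
    congr 1
    abel
  rw [← hDapp, ← hDapp, xxzBond_eq_half_planarPairs, map_add, map_smul, map_smul, map_add, map_smul,
    map_smul, hxy, hyx, hbond, show (f y - f x) ^ 2 = (f x - f y) ^ 2 by ring]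
  module

/-- **`[[Ŝ^α_x, C], C] = f_x² Ŝ^α_x`** for a PLANAR component `α ∈ {x, y}` and `C = Σ_z f_z Ŝᶻ_z` (the
field part of Mermin–Wagner's double commutator). Mermin–Wagner (1966) p. 1134. [cite: MerminWagnerPRL1966, p. 1134] -/
theorem doubleComm_siteSpin_planar_rotZ (f : Λ → ℂ) (x : Λ) {α : Fin 3} (hα : α ≠ 2) (C : Op Λ (n + 1))
    (hC : C = ∑ z, f z • siteSpin n z 2) :
    (siteSpin n x α * C - C * siteSpin n x α) * C - C * (siteSpin n x α * C - C * siteSpin n x α) =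
      (f x) ^ 2 • siteSpin n x α := by
  subst hC
  have h : α = 0 ∨ α = 1 := by
    fin_cases α
    · exact Or.inl rfl
    · exact Or.inr rfl
    · exact absurd rfl hα
  rcases h with rfl | rfl
  · rw [doubleComm_of_comm_sub_eq_smul (siteSpin_zero_comm_rotZ n f x) (siteSpin_one_comm_rotZ n f x)]
    congr 1
    ring_nf
    rw [I_sq]
    ring
  · rw [doubleComm_of_comm_sub_eq_smul (siteSpin_one_comm_rotZ n f x) (siteSpin_zero_comm_rotZ n f x)]
    congr 1
    ring_nf
    rw [I_sq]
    ring

end RotZ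

/-! ### §2 Mermin–Wagner's double commutator for the XXZ model in an inhomogeneous planar field, and for the
Heisenberg model in an inhomogeneous axial field -/

section Hamiltonian

variable {Λ : Type*} [Fintype Λ] [DecidableEq Λ] (n : ℕ) (G : SimpleGraph Λ) [DecidableRel G.Adj]

/-- **Mermin–Wagner's double commutator for the XXZ model in a planar field, real space.** For
`K = J Σ_{⟨x,y⟩} (Ŝˣ_xŜˣ_y + Ŝʸ_xŜʸ_y + Δ Ŝᶻ_xŜᶻ_y) - Σ_x b_x Ŝ^α_x` with `α ∈ {x, y}` and ARBITRARY site-dependent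
field strengths `b_x`, and `C = Σ_z f_z Ŝᶻ_z`:
`[C, [K, C]] = C(KC - CK) - (KC - CK)C = -J Σ_{⟨x,y⟩} (f_x - f_y)² (B⁰_{xy} + B¹_{xy}) + Σ_x b_x f_x² Ŝ^α_x`.
This is the operator identity behind Mermin–Wagner's bound on `⟨[[C,H],C†]⟩` (PRL 17 (1966) p. 1134, written there for
the Heisenberg model with a staggered field `h(𝐊)` of arbitrary wave vector, "ferromagnetism or antiferromagnetism"), with
the plane wave replaced by a general weight `f` and the anisotropy `Δ` arbitrary (its term commutes with `C`).
[cite: MerminWagnerPRL1966, p. 1134] [cite: GelfertNolting2001, §3 eq. (47)] -/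
theorem doubleComm_xxz_with_planarField (f : Λ → ℂ) (J Δ : ℝ) (b : Λ → ℂ) {α : Fin 3} (hα : α ≠ 2)
    (C K : Op Λ (n + 1)) (hC : C = ∑ z, f z • siteSpin n z 2)
    (hK : K = xxzHamiltonian n G J Δ - ∑ x, b x • siteSpin n x α) :
    C * (K * C - C * K) - (K * C - C * K) * C =
      -((J : ℂ) • ∑ e ∈ G.edgeFinset,
          Sym2.lift ⟨fun x y => (f x - f y) ^ 2 • (spinBond n 0 x y + spinBond n 1 x y),
            planarBondWeight_symm n f⟩ e) +
        ∑ x, (b x * (f x) ^ 2) • siteSpin n x α := by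
  set D : Op Λ (n + 1) →ₗ[ℂ] Op Λ (n + 1) :=
    LinearMap.mulRight ℂ C - LinearMap.mulLeft ℂ C with hD
  have hDapp : ∀ Z : Op Λ (n + 1), D Z = Z * C - C * Z := fun Z => rfl
  have key : C * (K * C - C * K) - (K * C - C * K) * C = -(D (D K)) := by
    simp only [hDapp]
    noncomm_ring
  rw [key, hK]
  simp only [map_sub, map_smul, xxzHamiltonian, map_sum]
  have hedge : ∀ e ∈ G.edgeFinset, D (D (Sym2.lift ⟨fun x y => spinBond n 0 x y + spinBond n 1 x y +
      (Δ : ℂ) • spinBond n 2 x y, fun x y => by simp only [spinBond_comm]⟩ e)) =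
      Sym2.lift ⟨fun x y => (f x - f y) ^ 2 • (spinBond n 0 x y + spinBond n 1 x y),
        planarBondWeight_symm n f⟩ e := by
    intro e _
    induction e using Sym2.ind with
    | h x y =>
      rw [Sym2.lift_mk, Sym2.lift_mk, hDapp, hDapp]
      exact doubleComm_xxzBond_rotZ n f Δ x y C hC
  have hfield : ∀ x ∈ (univ : Finset Λ), b x • D (D (siteSpin n x α)) = (b x * (f x) ^ 2) • siteSpin n x α := by
    intro x _
    rw [hDapp, hDapp, doubleComm_siteSpin_planar_rotZ n f x hα C hC, smul_smul]
  rw [Finset.sum_congr rfl hedge, Finset.sum_congr rfl hfield, neg_sub, sub_eq_neg_add]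

/-- **Mermin–Wagner's double commutator for the Heisenberg model in an inhomogeneous axial field**:
for `K = J Σ_{⟨x,y⟩} Ŝ_x·Ŝ_y - Σ_x b_x Ŝᶻ_x` and `C = Σ_z f_z Ŝˣ_z`,
`[C, [K, C]] = -J Σ_{⟨x,y⟩} (f_x - f_y)² (B¹_{xy} + B²_{xy}) + Σ_x b_x f_x² Ŝᶻ_x` (the tree's
`doubleComm_heisenberg_with_field` is the uniform-field case `b_x = h`). [cite: MerminWagnerPRL1966, p. 1134] -/
theorem doubleComm_heisenberg_with_axialField (f : Λ → ℂ) (J : ℝ) (b : Λ → ℂ) (C K : Op Λ (n + 1))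
    (hC : C = ∑ z, f z • siteSpin n z 0)
    (hK : K = heisenbergHamiltonian n G J - ∑ x, b x • siteSpin n x 2) :
    C * (K * C - C * K) - (K * C - C * K) * C =
      -((J : ℂ) • ∑ e ∈ G.edgeFinset,
          Sym2.lift ⟨fun x y => (f x - f y) ^ 2 • (spinBond n 1 x y + spinBond n 2 x y),
            mwBondWeight_symm n f⟩ e) +
        ∑ x, (b x * (f x) ^ 2) • siteSpin n x 2 := by
  set D : Op Λ (n + 1) →ₗ[ℂ] Op Λ (n + 1) :=
    LinearMap.mulRight ℂ C - LinearMap.mulLeft ℂ C with hD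
  have hDapp : ∀ Z : Op Λ (n + 1), D Z = Z * C - C * Z := fun Z => rfl
  have key : C * (K * C - C * K) - (K * C - C * K) * C = -(D (D K)) := by
    simp only [hDapp]
    noncomm_ring
  rw [key, hK]
  simp only [map_sub, map_smul, heisenbergHamiltonian, map_sum]
  have hedge : ∀ e ∈ G.edgeFinset, D (D (spinDotSym n e)) =
      Sym2.lift ⟨fun x y => (f x - f y) ^ 2 • (spinBond n 1 x y + spinBond n 2 x y),
        mwBondWeight_symm n f⟩ e := by
    intro e _
    induction e using Sym2.ind with
    | h x y =>
      rw [spinDotSym_mk, Sym2.lift_mk, hDapp, hDapp, hC]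
      exact doubleComm_spinDot n f x y
  have hfield : ∀ x ∈ (univ : Finset Λ), b x • D (D (siteSpin n x 2)) = (b x * (f x) ^ 2) • siteSpin n x 2 := by
    intro x _
    rw [hDapp, hDapp, hC, doubleComm_siteSpin_two n f x, smul_smul]
  rw [Finset.sum_congr rfl hedge, Finset.sum_congr rfl hfield, neg_sub, sub_eq_neg_add]

end Hamiltonian

/-! ### §3 The local Mermin–Wagner bounds (any finite graph, any real weight, any field profile) -/

section LocalBound

variable {Λ : Type*} [Fintype Λ] [DecidableEq Λ] (n : ℕ) (G : SimpleGraph Λ) [DecidableRel G.Adj]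

/-- `|Re ⟨(f_x - f_y)² (B⁰_{xy} + B¹_{xy})⟩| ≤ 2S² (f_x - f_y)²` per bond (`-S² ≤ Bᵅ_{xy} ≤ S²`).
Mermin–Wagner (1966), p. 1134. [cite: MerminWagnerPRL1966, p. 1134] -/
theorem abs_re_gibbsState_planarBondWeight_le {H : Op Λ (n + 1)} (hH : H.IsHermitian) (β : ℝ)
    (f : Λ → ℝ) (e : Sym2 Λ) :
    |(gibbsState β H (Sym2.lift ⟨fun x y => (((f x : ℝ) : ℂ) - f y) ^ 2 •
        (spinBond n 0 x y + spinBond n 1 x y), planarBondWeight_symm n fun z => (f z : ℂ)⟩ e)).re| ≤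
      2 * ((n : ℝ) / 2) ^ 2 * Sym2.lift ⟨fun x y => (f x - f y) ^ 2, fun x y => by ring⟩ e := by
  induction e using Sym2.ind with
  | h x y =>
    rw [Sym2.lift_mk, Sym2.lift_mk, LinearMap.map_smul, smul_eq_mul,
      show (((f x : ℝ) : ℂ) - f y) ^ 2 = (((f x - f y) ^ 2 : ℝ) : ℂ) by push_cast; ring,
      Complex.re_ofReal_mul, abs_mul, abs_of_nonneg (sq_nonneg _), mul_comm]
    refine mul_le_mul_of_nonneg_right ?_ (sq_nonneg _)
    have hS2 : (((n : ℂ) / 2) ^ 2).re = ((n : ℝ) / 2) ^ 2 := by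
      rw [show ((n : ℂ) / 2) ^ 2 = ((((n : ℝ) / 2) ^ 2 : ℝ) : ℂ) by push_cast; ring,
        Complex.ofReal_re]
    have h1 := abs_re_gibbsState_le_of_posSemidef hH β
      (posSemidef_sq_smul_one_sub_spinBond n 0 x y) (posSemidef_sq_smul_one_add_spinBond n 0 x y)
    have h2 := abs_re_gibbsState_le_of_posSemidef hH β
      (posSemidef_sq_smul_one_sub_spinBond n 1 x y) (posSemidef_sq_smul_one_add_spinBond n 1 x y)
    rw [hS2] at h1 h2
    rw [map_add, Complex.add_re]
    calc |(gibbsState β H (spinBond n 0 x y)).re + (gibbsState β H (spinBond n 1 x y)).re|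
        ≤ |(gibbsState β H (spinBond n 0 x y)).re| + |(gibbsState β H (spinBond n 1 x y)).re| :=
          abs_add_le _ _
      _ ≤ ((n : ℝ) / 2) ^ 2 + ((n : ℝ) / 2) ^ 2 := add_le_add h1 h2
      _ = 2 * ((n : ℝ) / 2) ^ 2 := by ring

/-- `|Re ⟨(b_x f_x²) Ŝ^α_x⟩| ≤ S |b_x| f_x²` per site (`-S ≤ Ŝ^α_x ≤ S`). Mermin–Wagner (1966), p. 1134.
[cite: MerminWagnerPRL1966, p. 1134] -/
theorem abs_re_gibbsState_field_smul_siteSpin_le {H : Op Λ (n + 1)} (hH : H.IsHermitian) (β : ℝ)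
    (b f : Λ → ℝ) (x : Λ) (α : Fin 3) :
    |(gibbsState β H ((((b x : ℝ) : ℂ) * (((f x : ℝ) : ℂ)) ^ 2) • siteSpin n x α)).re| ≤
      (n : ℝ) / 2 * (|b x| * (f x) ^ 2) := by
  rw [LinearMap.map_smul, smul_eq_mul,
    show ((b x : ℝ) : ℂ) * (((f x : ℝ) : ℂ)) ^ 2 = (((b x * (f x) ^ 2 : ℝ)) : ℂ) by push_cast; ring,
    Complex.re_ofReal_mul, abs_mul, abs_mul, abs_of_nonneg (sq_nonneg (f x)), mul_comm]
  refine mul_le_mul_of_nonneg_right ?_ (mul_nonneg (abs_nonneg _) (sq_nonneg _))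
  have hS : (((n : ℂ) / 2)).re = (n : ℝ) / 2 := by
    rw [show ((n : ℂ) / 2) = ((((n : ℝ) / 2) : ℝ) : ℂ) by push_cast; ring, Complex.ofReal_re]
  have h1 := abs_re_gibbsState_le_of_posSemidef hH β
    (posSemidef_smul_one_sub_siteSpin n x α) (posSemidef_smul_one_add_siteSpin n x α)
  rwa [hS] at h1

/-- `K = H^{XXZ} - Σ_x b_x Ŝ^α_x` is Hermitian for real field strengths (Mermin–Wagner's Hamiltonian (1) with
anisotropy and a site-dependent field). [cite: MerminWagnerPRL1966, eq. (1)] -/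
theorem xxzHamiltonian_sub_field_isHermitian (J Δ : ℝ) (b : Λ → ℝ) (α : Fin 3) :
    (xxzHamiltonian n G J Δ - ∑ x, ((b x : ℝ) : ℂ) • siteSpin n x α : Op Λ (n + 1)).IsHermitian :=
  (xxzHamiltonian_isHermitian n G J Δ).sub (sum_smul_siteSpin_isHermitian n b α)

/-- `K = H^{Heis} - Σ_x b_x Ŝᶻ_x` is Hermitian for real field strengths (Mermin–Wagner's Hamiltonian (1) with a
site-dependent field). [cite: MerminWagnerPRL1966, eq. (1)] -/
theorem heisenbergHamiltonian_sub_axialField_isHermitian (J : ℝ) (b : Λ → ℝ) :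
    (heisenbergHamiltonian n G J - ∑ x, ((b x : ℝ) : ℂ) • siteSpin n x 2 : Op Λ (n + 1)).IsHermitian :=
  (heisenbergHamiltonian_isHermitian n G J).sub (sum_smul_siteSpin_isHermitian n b 2)

/-- **The local Mermin–Wagner bound for a PLANAR component of the XXZ model in a planar field (any finite graph,
any real weight, any field profile).** For `K = J Σ_{⟨x,y⟩} (Ŝˣ_xŜˣ_y + Ŝʸ_xŜʸ_y + Δ Ŝᶻ_xŜᶻ_y) - Σ_x b_x Ŝ^α_x`,
`α ∈ {x, y}`, at inverse temperature `β ≥ 0`, and every `f : Λ → ℝ` with `f(o) = 1`: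
`(Re ⟨Ŝ^α_o⟩_{β,K})² ≤ β S² (2|J| S² Σ_{⟨x,y⟩} (f_x - f_y)² + S Σ_x |b_x| f_x²)` (`S = n/2`).
Bogoliubov's inequality `|⟨[C,A]⟩|² ≤ β ⟨A²⟩ ⟨[C,[K,C]]⟩` with `C = Σ_x f_x Ŝᶻ_x` (the deformed generator of the
`U(1)` symmetry of `H^{XXZ}`) and `A` the OTHER planar spin component at `o` (`[C, A] = ∓i f_o Ŝ^α_o`), together with
`⟨A²⟩ ≤ S²` and the double-commutator bound — steps (a)–(d) of Mermin–Wagner's proof (PRL 17 (1966) 1133–1134;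
Gelfert–Nolting (2001) eqs. (43)–(48)), transcribed from the uniform/staggered field of the source to an arbitrary
field profile. [cite: MerminWagnerPRL1966, pp. 1133–1134] [cite: GelfertNolting2001, §3 eqs. (43)–(48)] -/
theorem sq_re_gibbsState_planarSpin_le (J Δ : ℝ) (b : Λ → ℝ) {α : Fin 3} (hα : α ≠ 2) {β : ℝ} (hβ : 0 ≤ β)
    (f : Λ → ℝ) (o : Λ) (hfo : f o = 1) :
    (gibbsState β (xxzHamiltonian n G J Δ - ∑ x, ((b x : ℝ) : ℂ) • siteSpin n x α) (siteSpin n o α)).re ^ 2 ≤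
      β * ((n : ℝ) / 2) ^ 2 *
        (|J| * (2 * ((n : ℝ) / 2) ^ 2) *
            ∑ e ∈ G.edgeFinset, Sym2.lift ⟨fun x y => (f x - f y) ^ 2, fun x y => by ring⟩ e +
          (n : ℝ) / 2 * ∑ x, |b x| * (f x) ^ 2) := by
  set K : Op Λ (n + 1) := xxzHamiltonian n G J Δ - ∑ x, ((b x : ℝ) : ℂ) • siteSpin n x α with hKdef
  set C : Op Λ (n + 1) := ∑ z, ((f z : ℝ) : ℂ) • siteSpin n z 2 with hCdef
  set S : ℝ := (n : ℝ) / 2 with hSdef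
  set E : ℝ := ∑ e ∈ G.edgeFinset, Sym2.lift ⟨fun x y => (f x - f y) ^ 2, fun x y => by ring⟩ e
    with hEdef
  set F : ℝ := ∑ x, |b x| * (f x) ^ 2 with hFdef
  have hK : K.IsHermitian := xxzHamiltonian_sub_field_isHermitian n G J Δ b α
  have hC : C.IsHermitian := sum_smul_siteSpin_isHermitian n f 2
  haveI : Nonempty (TensorIndex Λ (n + 1)) := ⟨fun _ => 0⟩
  -- the partner component `A` and `CA - AC = u Ŝ^α_o` with `‖u‖ = 1`
  obtain ⟨a', u, hu, hCA⟩ : ∃ (a' : Fin 3) (u : ℂ), ‖u‖ = 1 ∧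
      C * siteSpin n o a' - siteSpin n o a' * C = u • siteSpin n o α := by
    have h : α = 0 ∨ α = 1 := by
      fin_cases α
      · exact Or.inl rfl
      · exact Or.inr rfl
      · exact absurd rfl hα
    rcases h with rfl | rfl
    · refine ⟨1, -I, by simp, ?_⟩
      rw [← neg_sub, siteSpin_one_comm_rotZ n (fun z => ((f z : ℝ) : ℂ)) o, hfo]
      simp
    · refine ⟨0, I, by simp, ?_⟩
      rw [← neg_sub, siteSpin_zero_comm_rotZ n (fun z => ((f z : ℝ) : ℂ)) o, hfo]
      simp
  set A : Op Λ (n + 1) := siteSpin n o a' with hAdef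
  have hA : A.IsHermitian := siteSpin_isHermitian n o a'
  -- Bogoliubov's inequality
  have hB := bogoliubov_inequality hK hA hC hβ
  have hLHS : (gibbsState β K (siteSpin n o α)).re ^ 2 ≤ ‖gibbsState β K (C * A - A * C)‖ ^ 2 := by
    rw [hCA, LinearMap.map_smul, smul_eq_mul, norm_mul, hu, one_mul]
    have h1 := Complex.abs_re_le_norm (gibbsState β K (siteSpin n o α))
    exact sq_le_sq' (by linarith [neg_abs_le (gibbsState β K (siteSpin n o α)).re])
      ((le_abs_self _).trans h1)
  -- `0 ≤ ⟨A²⟩ ≤ S²`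
  have hS2re : (((n : ℂ) / 2) ^ 2).re = S ^ 2 := by
    rw [show ((n : ℂ) / 2) ^ 2 = ((((n : ℝ) / 2) ^ 2 : ℝ) : ℂ) by push_cast; ring, Complex.ofReal_re]
  have hA2 : (gibbsState β K (A * A)).re ≤ S ^ 2 := by
    have := re_gibbsState_le_of_posSemidef hK β (posSemidef_sq_smul_one_sub_siteSpin_sq n o a')
    rwa [hS2re] at this
  -- the double commutator
  have hDC := doubleComm_xxz_with_planarField n G (fun z => ((f z : ℝ) : ℂ)) J Δ (fun x => ((b x : ℝ) : ℂ)) hα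
    C K hCdef hKdef
  have hDC0 : 0 ≤ (gibbsState β K (C * (K * C - C * K) - (K * C - C * K) * C)).re :=
    hK.re_gibbsState_doubleComm_nonneg hC hβ
  have hDCle : (gibbsState β K (C * (K * C - C * K) - (K * C - C * K) * C)).re ≤
      |J| * (2 * S ^ 2) * E + S * F := by
    rw [hDC, map_add, map_neg, LinearMap.map_smul, map_sum, map_sum, Complex.add_re, Complex.neg_re,
      smul_eq_mul, Complex.re_ofReal_mul, Complex.re_sum, Complex.re_sum]
    refine add_le_add ?_ ?_
    · calc -(J * ∑ e ∈ G.edgeFinset, (gibbsState β K (Sym2.lift ⟨fun x y =>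
            (((f x : ℝ) : ℂ) - f y) ^ 2 • (spinBond n 0 x y + spinBond n 1 x y),
              planarBondWeight_symm n fun z => (f z : ℂ)⟩ e)).re)
          ≤ |J| * ∑ e ∈ G.edgeFinset, |(gibbsState β K (Sym2.lift ⟨fun x y =>
            (((f x : ℝ) : ℂ) - f y) ^ 2 • (spinBond n 0 x y + spinBond n 1 x y),
              planarBondWeight_symm n fun z => (f z : ℂ)⟩ e)).re| := by
            refine (neg_le_abs _).trans ?_
            rw [abs_mul]
            exact mul_le_mul_of_nonneg_left (Finset.abs_sum_le_sum_abs _ _) (abs_nonneg _)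
        _ ≤ |J| * ∑ e ∈ G.edgeFinset, 2 * S ^ 2 *
            Sym2.lift ⟨fun x y => (f x - f y) ^ 2, fun x y => by ring⟩ e :=
            mul_le_mul_of_nonneg_left (Finset.sum_le_sum fun e _ =>
              abs_re_gibbsState_planarBondWeight_le n hK β f e) (abs_nonneg _)
        _ = |J| * (2 * S ^ 2) * E := by rw [← Finset.mul_sum, hEdef]; ring
    · calc ∑ x, (gibbsState β K ((((b x : ℝ) : ℂ) * (((f x : ℝ) : ℂ)) ^ 2) • siteSpin n x α)).re
          ≤ ∑ x, |(gibbsState β K ((((b x : ℝ) : ℂ) * (((f x : ℝ) : ℂ)) ^ 2) • siteSpin n x α)).re| :=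
            Finset.sum_le_sum fun x _ => le_abs_self _
        _ ≤ ∑ x, S * (|b x| * (f x) ^ 2) :=
            Finset.sum_le_sum fun x _ => abs_re_gibbsState_field_smul_siteSpin_le n hK β b f x α
        _ = S * F := by rw [← Finset.mul_sum, hFdef]
  -- assemble
  have hSβ : 0 ≤ β * S ^ 2 := mul_nonneg hβ (sq_nonneg _)
  calc (gibbsState β K (siteSpin n o α)).re ^ 2
      ≤ ‖gibbsState β K (C * A - A * C)‖ ^ 2 := hLHS
    _ ≤ β * (gibbsState β K (A * A)).re *
          (gibbsState β K (C * (K * C - C * K) - (K * C - C * K) * C)).re := hB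
    _ ≤ β * S ^ 2 * (gibbsState β K (C * (K * C - C * K) - (K * C - C * K) * C)).re := by
        refine mul_le_mul_of_nonneg_right (mul_le_mul_of_nonneg_left hA2 hβ) hDC0
    _ ≤ β * S ^ 2 * (|J| * (2 * S ^ 2) * E + S * F) :=
        mul_le_mul_of_nonneg_left hDCle hSβ

/-- **The local Mermin–Wagner bound for the AXIAL component of the Heisenberg model in an axial field**:
for `K = J Σ_{⟨x,y⟩} Ŝ_x·Ŝ_y - Σ_x b_x Ŝᶻ_x`, `β ≥ 0`, `f(o) = 1`:
`(Re ⟨Ŝᶻ_o⟩_{β,K})² ≤ β S² (2|J| S² Σ_{⟨x,y⟩} (f_x - f_y)² + S Σ_x |b_x| f_x²)` — `C = Σ_x f_x Ŝˣ_x`, `A = Ŝʸ_o`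
exactly as in the tree's uniform-field bound `sq_re_gibbsState_siteSpin_le`. [cite: MerminWagnerPRL1966, pp. 1133–1134]
[cite: GelfertNolting2001, §3 eqs. (43)–(48)] -/
theorem sq_re_gibbsState_axialSpin_heisenberg_le (J : ℝ) (b : Λ → ℝ) {β : ℝ} (hβ : 0 ≤ β)
    (f : Λ → ℝ) (o : Λ) (hfo : f o = 1) :
    (gibbsState β (heisenbergHamiltonian n G J - ∑ x, ((b x : ℝ) : ℂ) • siteSpin n x 2) (siteSpin n o 2)).re ^ 2 ≤
      β * ((n : ℝ) / 2) ^ 2 *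
        (|J| * (2 * ((n : ℝ) / 2) ^ 2) *
            ∑ e ∈ G.edgeFinset, Sym2.lift ⟨fun x y => (f x - f y) ^ 2, fun x y => by ring⟩ e +
          (n : ℝ) / 2 * ∑ x, |b x| * (f x) ^ 2) := by
  set K : Op Λ (n + 1) := heisenbergHamiltonian n G J - ∑ x, ((b x : ℝ) : ℂ) • siteSpin n x 2 with hKdef
  set C : Op Λ (n + 1) := ∑ z, ((f z : ℝ) : ℂ) • siteSpin n z 0 with hCdef
  set A : Op Λ (n + 1) := siteSpin n o 1 with hAdef
  set S : ℝ := (n : ℝ) / 2 with hSdef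
  set E : ℝ := ∑ e ∈ G.edgeFinset, Sym2.lift ⟨fun x y => (f x - f y) ^ 2, fun x y => by ring⟩ e
    with hEdef
  set F : ℝ := ∑ x, |b x| * (f x) ^ 2 with hFdef
  have hK : K.IsHermitian := heisenbergHamiltonian_sub_axialField_isHermitian n G J b
  have hA : A.IsHermitian := siteSpin_isHermitian n o 1
  have hC : C.IsHermitian := sum_smul_siteSpin_isHermitian n f 0
  haveI : Nonempty (TensorIndex Λ (n + 1)) := ⟨fun _ => 0⟩
  have hB := bogoliubov_inequality hK hA hC hβ
  have hCA : C * A - A * C = I • siteSpin n o 2 := by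
    have h1 := siteSpin_one_comm_sub n (fun z => ((f z : ℝ) : ℂ)) o
    rw [← neg_sub, h1, hfo]
    simp
  have hLHS : (gibbsState β K (siteSpin n o 2)).re ^ 2 ≤ ‖gibbsState β K (C * A - A * C)‖ ^ 2 := by
    rw [hCA, LinearMap.map_smul, smul_eq_mul, norm_mul, Complex.norm_I, one_mul]
    have h1 := Complex.abs_re_le_norm (gibbsState β K (siteSpin n o 2))
    exact sq_le_sq' (by linarith [neg_abs_le (gibbsState β K (siteSpin n o 2)).re])
      ((le_abs_self _).trans h1)
  have hS2re : (((n : ℂ) / 2) ^ 2).re = S ^ 2 := by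
    rw [show ((n : ℂ) / 2) ^ 2 = ((((n : ℝ) / 2) ^ 2 : ℝ) : ℂ) by push_cast; ring, Complex.ofReal_re]
  have hA2 : (gibbsState β K (A * A)).re ≤ S ^ 2 := by
    have := re_gibbsState_le_of_posSemidef hK β (posSemidef_sq_smul_one_sub_siteSpin_sq n o 1)
    rwa [hS2re] at this
  have hDC := doubleComm_heisenberg_with_axialField n G (fun z => ((f z : ℝ) : ℂ)) J
    (fun x => ((b x : ℝ) : ℂ)) C K hCdef hKdef
  have hDC0 : 0 ≤ (gibbsState β K (C * (K * C - C * K) - (K * C - C * K) * C)).re :=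
    hK.re_gibbsState_doubleComm_nonneg hC hβ
  have hDCle : (gibbsState β K (C * (K * C - C * K) - (K * C - C * K) * C)).re ≤
      |J| * (2 * S ^ 2) * E + S * F := by
    rw [hDC, map_add, map_neg, LinearMap.map_smul, map_sum, map_sum, Complex.add_re, Complex.neg_re,
      smul_eq_mul, Complex.re_ofReal_mul, Complex.re_sum, Complex.re_sum]
    refine add_le_add ?_ ?_
    · calc -(J * ∑ e ∈ G.edgeFinset, (gibbsState β K (Sym2.lift ⟨fun x y =>
            (((f x : ℝ) : ℂ) - f y) ^ 2 • (spinBond n 1 x y + spinBond n 2 x y),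
              mwBondWeight_symm n fun z => (f z : ℂ)⟩ e)).re)
          ≤ |J| * ∑ e ∈ G.edgeFinset, |(gibbsState β K (Sym2.lift ⟨fun x y =>
            (((f x : ℝ) : ℂ) - f y) ^ 2 • (spinBond n 1 x y + spinBond n 2 x y),
              mwBondWeight_symm n fun z => (f z : ℂ)⟩ e)).re| := by
            refine (neg_le_abs _).trans ?_
            rw [abs_mul]
            exact mul_le_mul_of_nonneg_left (Finset.abs_sum_le_sum_abs _ _) (abs_nonneg _)
        _ ≤ |J| * ∑ e ∈ G.edgeFinset, 2 * S ^ 2 *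
            Sym2.lift ⟨fun x y => (f x - f y) ^ 2, fun x y => by ring⟩ e :=
            mul_le_mul_of_nonneg_left (Finset.sum_le_sum fun e _ =>
              abs_re_gibbsState_mwBondWeight_le n hK β f e) (abs_nonneg _)
        _ = |J| * (2 * S ^ 2) * E := by rw [← Finset.mul_sum, hEdef]; ring
    · calc ∑ x, (gibbsState β K ((((b x : ℝ) : ℂ) * (((f x : ℝ) : ℂ)) ^ 2) • siteSpin n x 2)).re
          ≤ ∑ x, |(gibbsState β K ((((b x : ℝ) : ℂ) * (((f x : ℝ) : ℂ)) ^ 2) • siteSpin n x 2)).re| :=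
            Finset.sum_le_sum fun x _ => le_abs_self _
        _ ≤ ∑ x, S * (|b x| * (f x) ^ 2) :=
            Finset.sum_le_sum fun x _ => abs_re_gibbsState_field_smul_siteSpin_le n hK β b f x 2
        _ = S * F := by rw [← Finset.mul_sum, hFdef]
  have hSβ : 0 ≤ β * S ^ 2 := mul_nonneg hβ (sq_nonneg _)
  calc (gibbsState β K (siteSpin n o 2)).re ^ 2
      ≤ ‖gibbsState β K (C * A - A * C)‖ ^ 2 := hLHS
    _ ≤ β * (gibbsState β K (A * A)).re *
          (gibbsState β K (C * (K * C - C * K) - (K * C - C * K) * C)).re := hB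
    _ ≤ β * S ^ 2 * (gibbsState β K (C * (K * C - C * K) - (K * C - C * K) * C)).re := by
        refine mul_le_mul_of_nonneg_right (mul_le_mul_of_nonneg_left hA2 hβ) hDC0
    _ ≤ β * S ^ 2 * (|J| * (2 * S ^ 2) * E + S * F) :=
        mul_le_mul_of_nonneg_left hDCle hSβ

end LocalBound

/-! ### §4 The sourced XXZ antiferromagnet: any graph, then the torus `(ℤ/Lℤ)^d`, `d ≤ 2`, uniformly in `L` -/

namespace XXZKT

section Graph

variable {Λ : Type*} [Fintype Λ] [DecidableEq Λ] (n : ℕ) (G : SimpleGraph Λ) [DecidableRel G.Adj]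

/-- `xxzHamiltonian n G J 1 = heisenbergHamiltonian n G J` (each edge term is `𝐒_x·𝐒_y`); private copy of the
tree's (private) `XXZKT.xxzHamiltonian_one_eq_heisenberg`. [cite: Tasaki2020, §2.4 (remarks after eq. (2.4.1))] -/
private theorem xxzHamiltonian_one_eq_heisenberg' (J : ℝ) :
    xxzHamiltonian n G J 1 = heisenbergHamiltonian n G J := by
  rw [xxzHamiltonian, heisenbergHamiltonian]
  congr 1
  refine sum_congr rfl fun e _ => ?_
  induction e using Sym2.ind with
  | h x y =>
    simp only [Sym2.lift_mk, spinDotSym_mk, spinDot, Fin.sum_univ_three, Complex.ofReal_one, one_smul]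

/-- The staggered source as an inhomogeneous field: `B·O^α = Σ_x (B(-1)^{σ(x)}) Ŝ^α_x` with REAL site strengths.
[cite: KomaTasaki1993, §1 (1.2), (1.8)] -/
theorem smul_stagSpin_eq_sum_field (σ : Λ → ℕ) (α : Fin 3) (B : ℝ) :
    ((B : ℂ) • stagSpin n σ α : Op Λ (n + 1)) = ∑ x, (((B * stagSign σ x : ℝ)) : ℂ) • siteSpin n x α := by
  rw [stagSpin, Finset.smul_sum]
  refine Finset.sum_congr rfl fun x _ => ?_
  rw [smul_smul, Complex.ofReal_mul]

/-- **The local Mermin–Wagner bound for the sourced XXZ antiferromagnet `K = H^{XXZ}(J, Δ) - B·O^α` on any finite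
graph, any staggering `σ`.** If the source is PLANAR (`α ∈ {x, y}`, any anisotropy `Δ`) or the model is ISOTROPIC
(`Δ = 1`, any `α`), then for `β ≥ 0` and every real weight `f` with `f(o) = 1`:
`(Re ⟨Ŝ^α_o⟩_{β,K})² ≤ β S² (2|J| S² Σ_{⟨x,y⟩} (f_x - f_y)² + |B| S Σ_x f_x²)`.
(For `Δ ≠ 1` and the axial source `α = z` no continuous symmetry is broken and no such bound holds: the Ising-like
XXZ model orders in `d = 2` at low temperature.) [cite: MerminWagnerPRL1966, pp. 1133–1134]
[cite: GelfertNolting2001, §3 eqs. (43)–(48)] -/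
theorem sq_re_gibbsState_siteSpin_sourced_le (σ : Λ → ℕ) (J Δ : ℝ) {α : Fin 3} (hα : α ≠ 2 ∨ Δ = 1) (B : ℝ)
    {β : ℝ} (hβ : 0 ≤ β) (f : Λ → ℝ) (o : Λ) (hfo : f o = 1) :
    (gibbsState β (xxzHamiltonian n G J Δ - (B : ℂ) • stagSpin n σ α) (siteSpin n o α)).re ^ 2 ≤
      β * ((n : ℝ) / 2) ^ 2 *
        (|J| * (2 * ((n : ℝ) / 2) ^ 2) *
            ∑ e ∈ G.edgeFinset, Sym2.lift ⟨fun x y => (f x - f y) ^ 2, fun x y => by ring⟩ e +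
          |B| * ((n : ℝ) / 2) * ∑ x, (f x) ^ 2) := by
  have hF : ∑ x, |B * stagSign σ x| * (f x) ^ 2 = |B| * ∑ x, (f x) ^ 2 := by
    rw [Finset.mul_sum]
    refine sum_congr rfl fun x _ => ?_
    rw [abs_mul, abs_stagSign, mul_one]
  rw [smul_stagSpin_eq_sum_field]
  by_cases h2 : α = 2
  · subst h2
    have hΔ : Δ = 1 := hα.resolve_left (not_not.2 rfl)
    subst hΔ
    rw [xxzHamiltonian_one_eq_heisenberg']
    calc _ ≤ _ := sq_re_gibbsState_axialSpin_heisenberg_le n G J (fun x => B * stagSign σ x) hβ f o hfo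
      _ = _ := by rw [hF]; ring
  · calc _ ≤ _ := sq_re_gibbsState_planarSpin_le n G J Δ (fun x => B * stagSign σ x) h2 hβ f o hfo
      _ = _ := by rw [hF]; ring

end Graph

section Torus

variable {d : ℕ}

/-- **THE LOCAL BOUND ON THE TORUS WITH THE HARMONIC TEST FUNCTION (uniform in the volume).** For `d ∈ {1, 2}`,
`L ≥ 1`, every spin `S = n/2`, couplings `J`, anisotropy `Δ`, source direction `α` with `α ∈ {x, y}` or `Δ = 1`,
source strength `B`, inverse temperature `β ≥ 0`, every `R ≥ 1` and every site `o` of `(ℤ/Lℤ)^d`: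
`(Re ⟨Ŝ^α_o⟩_{β, H^{XXZ} - B·O^α})² ≤ β S² (2|J| S² · 64/H_R + |B| S · 4R²)`, `H_R = Σ_{k<R} 1/(k+1)`,
uniformly in `L` — test function `f(x) = g(dist(x, o))`, `g(r) = (H_R - H_r)/H_R`, exactly as in the tree's
uniform-field bound `sq_re_gibbsState_siteSpin_torus_le` (Mermin–Wagner's `k`-space infrared divergence replaced by
the vanishing capacity of a point in `d ≤ 2`). [cite: MerminWagnerPRL1966, pp. 1133–1135] -/
theorem sq_re_gibbsState_siteSpin_sourcedAF_le (hd1 : 1 ≤ d) (hd2 : d ≤ 2) (L : ℕ) [NeZero L] (n : ℕ)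
    (J Δ : ℝ) {α : Fin 3} (hα : α ≠ 2 ∨ Δ = 1) (B : ℝ) {β : ℝ} (hβ : 0 ≤ β) {R : ℕ} (hR : 1 ≤ R)
    (o : TorusSite d L) :
    (gibbsState β (sourcedAF d L n J Δ α B) (siteSpin n o α)).re ^ 2 ≤
      β * ((n : ℝ) / 2) ^ 2 *
        (|J| * (2 * ((n : ℝ) / 2) ^ 2) * (64 / ∑ k ∈ range R, (1 : ℝ) / (k + 1)) +
          |B| * ((n : ℝ) / 2) * (4 * (R : ℝ) ^ 2)) := by
  set HR : ℝ := ∑ k ∈ range R, (1 : ℝ) / (k + 1) with hHR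
  set g : ℕ → ℝ := fun r => (∑ k ∈ Ico r R, (1 : ℝ) / (k + 1)) / HR with hg
  set f : TorusSite d L → ℝ := fun x => g (torusDist x o) with hf
  have hHR1 : 1 ≤ HR := one_le_sum_range_one_div_succ hR
  have hHR0 : 0 < HR := by linarith
  have hfo : f o = 1 := by
    simp only [hf, hg, torusDist_self]
    exact harmonicProfile_zero hR
  have hgR : ∀ r, R ≤ r → g r = 0 := fun r hr => harmonicProfile_eq_zero hr
  have hloc := sq_re_gibbsState_siteSpin_sourced_le n (torusGraph d L) (torusParityExp d L) J Δ hα B hβ f o hfo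
  -- the Dirichlet energy of `f`
  have hE : ∑ e ∈ (torusGraph d L).edgeFinset,
      Sym2.lift ⟨fun x y => (f x - f y) ^ 2, fun x y => by ring⟩ e ≤ 64 / HR := by
    have h1 := sum_edgeFinset_radial_sq_le (L := L) g o
    have h2 := sum_radial_le_sum_range (L := L) hd1 hd2 (Φ := fun r => (g r - g (r + 1)) ^ 2)
      (fun r => sq_nonneg _) (R := R) (fun r hr => by
        simp only [hgR r hr, hgR (r + 1) (by omega), sub_self, ne_eq, OfNat.ofNat_ne_zero,
          not_false_eq_true, zero_pow]) o
    have h3 := sum_shell_harmonicProfile_sq_le hR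
    have hd' : (4 : ℝ) * d ≤ 8 := by
      have : (d : ℝ) ≤ 2 := by exact_mod_cast hd2
      linarith
    have hsum0 : 0 ≤ ∑ u : TorusSite d L, (g (torusDist u o) - g (torusDist u o + 1)) ^ 2 :=
      sum_nonneg fun u _ => sq_nonneg _
    calc _ ≤ 4 * d * ∑ u : TorusSite d L, (g (torusDist u o) - g (torusDist u o + 1)) ^ 2 := h1
      _ ≤ 8 * (8 / HR) := mul_le_mul hd' (h2.trans h3) hsum0 (by norm_num)
      _ = 64 / HR := by ring
  -- the mass of `f`
  have hF : ∑ x, (f x) ^ 2 ≤ 4 * (R : ℝ) ^ 2 := by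
    have h1 := sum_radial_le_sum_range (L := L) hd1 hd2 (Φ := fun r => (g r) ^ 2)
      (fun r => sq_nonneg _) (R := R) (fun r hr => by
        simp only [hgR r hr, ne_eq, OfNat.ofNat_ne_zero, not_false_eq_true, zero_pow]) o
    have h2 : ∑ r ∈ range R, 4 * (2 * (r : ℝ) + 1) * (g r) ^ 2 ≤
        ∑ r ∈ range R, 4 * (2 * (r : ℝ) + 1) * 1 := by
      refine sum_le_sum fun r _ => mul_le_mul_of_nonneg_left ?_ (by positivity)
      have h0 : 0 ≤ g r := harmonicProfile_nonneg R r
      have h1 : g r ≤ 1 := harmonicProfile_le_one R r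
      nlinarith
    have h3 : ∑ r ∈ range R, 4 * (2 * (r : ℝ) + 1) * 1 = 4 * (R : ℝ) ^ 2 := by
      rw [← sum_range_two_mul_cast_add_one R, Finset.mul_sum]
      refine sum_congr rfl fun r _ => ?_
      ring
    exact h1.trans (h2.trans h3.le)
  -- assemble
  have hS0 : 0 ≤ ((n : ℝ) / 2) := by positivity
  refine hloc.trans (mul_le_mul_of_nonneg_left (add_le_add ?_ ?_) (mul_nonneg hβ (sq_nonneg _)))
  · exact mul_le_mul_of_nonneg_left hE (by positivity)
  · exact mul_le_mul_of_nonneg_left hF (by positivity)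

end Torus

/-! ### §5 Infinite volume: the sourced thermal limit states and the infinitesimal-field states of KT93 (1.8)
in `d ≤ 2` -/

section InfiniteVolume

variable {d n : ℕ}

variable {ρ : ∀ k : ℕ, Op (TorusSite d (2 * k + 2)) (n + 1) →ₗ[ℂ] ℂ} {ω : InfVolState d (n + 1)} {α : Fin 3}

/-- **A finite-volume one-point CEILING passes to every sourced limit state**: if `(Re ρ_k(Ŝ^α_y))² ≤ M` for all
tori and sites, then `(Re ω(Ŝ^α_x))² ≤ M` at every site of `ℤ^d` (one-site expectations converge along the torus
limit, `InfVolState.IsTorusLimitOf.tendsto_onSite`). [cite: KomaTasaki1993, §1 (1.8)–(1.9)]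
[cite: BratteliRobinsonII1997, §6.2.2] -/
theorem IsSourcedLimit.sq_re_expect_siteSpinAt_le (h : IsSourcedLimit ρ ω) {M : ℝ}
    (hM : ∀ (k : ℕ) (y : TorusSite d (2 * k + 2)), (ρ k (siteSpin n y α)).re ^ 2 ≤ M) (x : Site d) :
    (ω.expect {x} (siteSpinAt n x α)).re ^ 2 ≤ M := by
  obtain ⟨κ, -, hω⟩ := h
  have ht := ((Complex.continuous_re.tendsto _).comp (hω.tendsto_onSite x (spinVec n α))).pow 2
  refine le_of_tendsto' ht fun j => ?_
  rw [Function.comp_apply, show (onSite (Torus.proj (2 * κ j + 2) x) (spinVec n α) :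
      Op (TorusSite d (2 * κ j + 2)) (n + 1)) = siteSpin n (Torus.proj (2 * κ j + 2) x) α from rfl]
  exact hM (κ j) _

variable {ρB : ℝ → ∀ k : ℕ, Op (TorusSite d (2 * k + 2)) (n + 1) →ₗ[ℂ] ℂ}

/-- **A ceiling affine in the source strength passes to the limit `B ↓ 0` with its constant term**: if every
sourced limit state at every `B > 0` has `(Re ω_B(Ŝ^α_x))² ≤ M₀ + M₁B`, then every infinitesimal-field state has
`(Re ω(Ŝ^α_x))² ≤ M₀`. [cite: KomaTasaki1993, §1 (1.8)–(1.9)] -/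
theorem IsInfinitesimalFieldState.sq_re_expect_siteSpinAt_le (h : IsInfinitesimalFieldState ρB ω) {M₀ M₁ : ℝ}
    (hB : ∀ B : ℝ, 0 < B → ∀ ω' : InfVolState d (n + 1), IsSourcedLimit (ρB B) ω' →
      ∀ x : Site d, (ω'.expect {x} (siteSpinAt n x α)).re ^ 2 ≤ M₀ + M₁ * B) (x : Site d) :
    (ω.expect {x} (siteSpinAt n x α)).re ^ 2 ≤ M₀ := by
  obtain ⟨B, ωB, hBpos, hB0, hωB, hlim⟩ := h
  have ht := ((Complex.continuous_re.tendsto _).comp (hlim {x} (siteSpinAt n x α))).pow 2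
  have hbound : Tendsto (fun m => M₀ + M₁ * B m) atTop (𝓝 M₀) := by
    simpa using (hB0.const_mul M₁).const_add M₀
  exact le_of_tendsto_of_tendsto' ht hbound fun m => hB (B m) (hBpos m) (ωB m) (hωB m) x

variable (d n)

/-- **MERMIN–WAGNER CEILING FOR THE SOURCED THERMAL LIMIT STATES, `d ≤ 2`.** For `d ∈ {1, 2}`, `β ≥ 0`, every
anisotropy `Δ` and a planar source direction `α ∈ {x, y}` (or `Δ = 1` and any `α`), every thermodynamic limit
`ω = lim_Λ ⟨·⟩_{β, H^{XXZ}_Λ - B·O^α_Λ}` along even tori (`IsSourcedThermalLimit`) satisfies, at every site and for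
every `R ≥ 1`, `(Re ω(Ŝ^α_x))² ≤ β S² (2|J| S² · 64/H_R + |B| S · 4R²)`: the sourced order parameter is
`O((log(1/|B|))^{-1/2})` as `B → 0`, Mermin–Wagner's `|s| < const (T|ln h|)^{-1/2}` in `d = 2`.
[cite: MerminWagnerPRL1966, pp. 1133–1135] [cite: KomaTasaki1993, §1 (1.8)–(1.9)] -/
theorem IsSourcedThermalLimit.sq_re_expect_siteSpinAt_le (hd1 : 1 ≤ d) (hd2 : d ≤ 2) {J Δ : ℝ}
    {α : Fin 3} (hα : α ≠ 2 ∨ Δ = 1) {β B : ℝ} (hβ : 0 ≤ β) {ω : InfVolState d (n + 1)}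
    (h : IsSourcedThermalLimit d n J Δ α β B ω) {R : ℕ} (hR : 1 ≤ R) (x : Site d) :
    (ω.expect {x} (siteSpinAt n x α)).re ^ 2 ≤
      β * ((n : ℝ) / 2) ^ 2 *
        (|J| * (2 * ((n : ℝ) / 2) ^ 2) * (64 / ∑ k ∈ range R, (1 : ℝ) / (k + 1)) +
          |B| * ((n : ℝ) / 2) * (4 * (R : ℝ) ^ 2)) :=
  IsSourcedLimit.sq_re_expect_siteSpinAt_le h
    (fun k y => sq_re_gibbsState_siteSpin_sourcedAF_le hd1 hd2 (2 * k + 2) n J Δ hα B hβ hR y) x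

/-- **MERMIN–WAGNER FOR THE INFINITESIMAL-FIELD STATES (KT93 (1.8)–(1.9)), `d ≤ 2`, `T > 0`: THE SPONTANEOUS
STAGGERED MAGNETISATION VANISHES.** For `d ∈ {1, 2}`, `β ≥ 0`, spin `S = n/2`, coupling `J`, anisotropy `Δ` and a
planar source direction `α ∈ {x, y}` — or `Δ = 1` (Heisenberg) and ANY direction `α` — every infinitesimal-field
thermal state `ω̃ = lim_{B↓0} lim_Λ ⟨·⟩_{β, H_Λ - BO^α_Λ}` of the XXZ antiferromagnet has `ω̃(Ŝ^α_x) = 0` at EVERY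
site `x ∈ ℤ^d`; in particular its spontaneous staggered magnetisation `m_s = (-1)^x Re ω̃(Ŝ^α_x)` (1.9) is `0`.
Proof: the finite-volume ceiling `sq_re_gibbsState_siteSpin_sourcedAF_le` is uniform in the volume, passes to the
sourced limit states with `|B| = B_m`, then to `B_m ↓ 0` leaving `(Re ω̃(Ŝ^α_x))² ≤ β S² · 2|J|S² · 64/H_R` for
every `R`, and `H_R → ∞`; the imaginary part vanishes because states are real on Hermitian elements.  CONTRAST
(tree): for `d ≥ 3` the same states have `m_s ≥ √2σ > 0` (`0 ≤ Δ ≤ 1`) resp. `√3σ` (`Δ = 1`) at low temperature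
(`xxzAF_infiniteVolume_spontaneousStaggeredMagnetisation`, `heisenbergAF_infiniteVolume_spontaneousStaggeredMagnetisation`),
and at `T = 0` already for `d ≥ 2` (`…_groundState_…`). Klein–Landau–Shucker (1981) prove the stronger statement that
EVERY KMS state in `d ≤ 2` is invariant under the continuous symmetry (not formalised).
[cite: MerminWagnerPRL1966, pp. 1133–1135] [cite: KomaTasaki1993, §1 (1.8)–(1.10)] [cite: KleinLandauShucker1981] -/
theorem IsInfinitesimalFieldThermalState.expect_siteSpinAt_eq_zero (hd1 : 1 ≤ d) (hd2 : d ≤ 2) {J Δ : ℝ}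
    {α : Fin 3} (hα : α ≠ 2 ∨ Δ = 1) {β : ℝ} (hβ : 0 ≤ β) {ω : InfVolState d (n + 1)}
    (h : IsInfinitesimalFieldThermalState d n J Δ α β ω) (x : Site d) :
    ω.expect {x} (siteSpinAt n x α) = 0 := by
  set S : ℝ := (n : ℝ) / 2 with hS
  set c : ℝ := β * S ^ 2 * (|J| * (2 * S ^ 2)) with hc
  have hc0 : 0 ≤ c := by positivity
  -- `(Re ω̃(Ŝ^α_x))² ≤ c · 64/H_R` for every `R ≥ 1`
  have hsq : ∀ {R : ℕ}, 1 ≤ R →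
      (ω.expect {x} (siteSpinAt n x α)).re ^ 2 ≤ c * (64 / ∑ k ∈ range R, (1 : ℝ) / (k + 1)) := by
    intro R hR
    refine IsInfinitesimalFieldState.sq_re_expect_siteSpinAt_le h (M₁ := β * S ^ 2 * (S * (4 * (R : ℝ) ^ 2)))
      (fun B hB ω' hω' y => ?_) x
    have h1 := IsSourcedLimit.sq_re_expect_siteSpinAt_le hω'
      (fun k z => sq_re_gibbsState_siteSpin_sourcedAF_le hd1 hd2 (2 * k + 2) n J Δ hα B hβ hR z) y
    rw [abs_of_pos hB] at h1
    calc _ ≤ _ := h1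
      _ = _ := by rw [hc, hS]; ring
  -- hence `≤ ε` for every `ε > 0`, i.e. `= 0`
  have hre0 : (ω.expect {x} (siteSpinAt n x α)).re ^ 2 ≤ 0 := by
    refine le_of_forall_pos_le_add fun ε hε => ?_
    obtain ⟨R, hR, hRge⟩ := exists_harmonicSum_ge (64 * c / ε)
    have hH0 : 0 < ∑ k ∈ range R, (1 : ℝ) / (k + 1) := by linarith [one_le_sum_range_one_div_succ hR]
    have h64 : 64 * c ≤ ε * ∑ k ∈ range R, (1 : ℝ) / (k + 1) := by
      have := (div_le_iff₀ hε).1 hRge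
      linarith
    have hfin : c * (64 / ∑ k ∈ range R, (1 : ℝ) / (k + 1)) ≤ ε := by
      rw [mul_div_assoc', div_le_iff₀ hH0]
      linarith
    linarith [hsq hR]
  have hre : (ω.expect {x} (siteSpinAt n x α)).re = 0 :=
    pow_eq_zero_iff (n := 2) (by norm_num) |>.1 (le_antisymm hre0 (sq_nonneg _))
  have him : (ω.expect {x} (siteSpinAt n x α)).im = 0 :=
    ω.im_expect_eq_zero_of_isHermitian {x} (siteSpin_isHermitian n _ α)
  exact Complex.ext hre him

/-- **THE XXZ ANTIFERROMAGNET IN `d ≤ 2`, `T > 0`: NO SPONTANEOUS PLANAR STAGGERED MAGNETISATION (every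
anisotropy `Δ`, every spin, every `β ≥ 0`).** (i) Every sourced thermal limit state at `B > 0` obeys Mermin–Wagner's
ceiling `(Re ω(Ŝ^α_x))² ≤ β S² (2|J| S² · 64/H_R + B S · 4R²)` for all `R ≥ 1`; (ii) every infinitesimal-field thermal
state (KT93 (1.8)) has `ω̃(Ŝ^α_x) = 0` at every site, `α ∈ {x, y}`.  Infinitesimal-field states exist
(`exists_isInfinitesimalFieldThermalState`); for `Δ > 1` the AXIAL (Ising) order is NOT excluded, and is not claimed.
[cite: MerminWagnerPRL1966, pp. 1133–1135] [cite: KomaTasaki1993, §1 (1.8)–(1.10)] -/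
theorem xxz_lowDimension_noSpontaneousPlanarMagnetisation (hd1 : 1 ≤ d) (hd2 : d ≤ 2) (J Δ : ℝ) {α : Fin 3}
    (hα : α ≠ 2) {β : ℝ} (hβ : 0 ≤ β) :
    (∀ B : ℝ, 0 < B → ∀ ω : InfVolState d (n + 1), IsSourcedThermalLimit d n J Δ α β B ω →
        ∀ (x : Site d) (R : ℕ), 1 ≤ R →
          (ω.expect {x} (siteSpinAt n x α)).re ^ 2 ≤
            β * ((n : ℝ) / 2) ^ 2 *
              (|J| * (2 * ((n : ℝ) / 2) ^ 2) * (64 / ∑ k ∈ range R, (1 : ℝ) / (k + 1)) +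
                B * ((n : ℝ) / 2) * (4 * (R : ℝ) ^ 2))) ∧
      ∀ ω : InfVolState d (n + 1), IsInfinitesimalFieldThermalState d n J Δ α β ω →
        ∀ x : Site d, ω.expect {x} (siteSpinAt n x α) = 0 := by
  refine ⟨fun B hB ω hω x R hR => ?_,
    fun ω hω x => IsInfinitesimalFieldThermalState.expect_siteSpinAt_eq_zero d n hd1 hd2 (Or.inl hα) hβ hω x⟩
  have h1 := IsSourcedThermalLimit.sq_re_expect_siteSpinAt_le d n hd1 hd2 (Or.inl hα) hβ hω hR x
  rwa [abs_of_pos hB] at h1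

/-- **THE HEISENBERG ANTIFERROMAGNET IN `d ≤ 2`, `T > 0`: NO SPONTANEOUS STAGGERED MAGNETISATION IN ANY
DIRECTION** (Mermin–Wagner, "absence of … antiferromagnetism in one- or two-dimensional isotropic Heisenberg
models"): for `d ∈ {1, 2}`, every spin `S = n/2`, every `J`, `β ≥ 0` and every source direction `α`, every
infinitesimal-field thermal state `ω̃` of `J Σ 𝐒_x·𝐒_y` has `ω̃(Ŝ^α_x) = 0` at every site — whereas for `d ≥ 3`,
`J > 0`, `β ≥ β₀` the same construction yields `(-1)^x Re ω̃(Ŝ^α_x) ≥ √3σ > 0`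
(`heisenbergAF_infiniteVolume_spontaneousStaggeredMagnetisation`) and two distinct dKMS states
(`heisenbergAF_dKMSState_not_unique`). [cite: MerminWagnerPRL1966, pp. 1133–1135 (title and main result)]
[cite: KomaTasaki1993, §1 (1.8)–(1.10)] -/
theorem heisenbergAF_lowDimension_noSpontaneousStaggeredMagnetisation (hd1 : 1 ≤ d) (hd2 : d ≤ 2) (J : ℝ)
    (α : Fin 3) {β : ℝ} (hβ : 0 ≤ β) {ω : InfVolState d (n + 1)}
    (hω : IsInfinitesimalFieldThermalState d n J 1 α β ω) (x : Site d) :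
    ω.expect {x} (siteSpinAt n x α) = 0 :=
  IsInfinitesimalFieldThermalState.expect_siteSpinAt_eq_zero d n hd1 hd2 (Or.inr rfl) hβ hω x

/-- Non-vacuity: in `d ≤ 2` at every `β ≥ 0` there IS an infinitesimal-field thermal state of the XXZ
antiferromagnet with planar source, and every such state has vanishing order parameter.
[cite: KomaTasaki1993, §1 (1.8)] [cite: MerminWagnerPRL1966, pp. 1133–1135] -/
theorem exists_infinitesimalFieldThermalState_and_forall_expect_eq_zero (hd1 : 1 ≤ d) (hd2 : d ≤ 2) (J Δ : ℝ)
    {α : Fin 3} (hα : α ≠ 2 ∨ Δ = 1) {β : ℝ} (hβ : 0 ≤ β) :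
    (∃ ω : InfVolState d (n + 1), IsInfinitesimalFieldThermalState d n J Δ α β ω) ∧
      ∀ ω : InfVolState d (n + 1), IsInfinitesimalFieldThermalState d n J Δ α β ω →
        ∀ x : Site d, ω.expect {x} (siteSpinAt n x α) = 0 :=
  ⟨exists_isInfinitesimalFieldThermalState J Δ α β,
    fun _ hω x => IsInfinitesimalFieldThermalState.expect_siteSpinAt_eq_zero d n hd1 hd2 hα hβ hω x⟩

end InfiniteVolume

end XXZKT

end Literature.MathematicalPhysics.QuantumLattice

end
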